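import Summits.ABC.StewartYu.PadicG3TwoSizes
import Literature.NumberTheory.Transcendental.Waldschmidt1980SizeHyp
import HarnessLib

/-!
# Cell abc-stewartyu, Gen-3 frame at `p = 2` (crux `Y07Two`, stmt-ABC-19659), record interface: CLOSED-FORM SIZES of
# the THIRD-STEP threshold of the schedule of record `schedTwoS` (`thirdDen`, `thirdM`, `heightProd`)

`Summits/ABC/StewartYu/PadicG3TwoSizesThird.lean` — cell `abc-stewartyu` (HOME `run/shared/lean/pub/abc-stewartyu/`),
route `PadicPrimesKummerThird`, seat p5 (g3); sequel to `PadicG3TwoSizes.lean`.  Theorems + one abbreviating def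
(`hsumS = ∑ⱼ h(αⱼ) + h(θ)`).  With `PadicG3TwoLogForm.log_thr_eq` / `branch_gain_lt_of_log` these turn the (L3ᴿ)
gain branch `Bw/(4·2^m)^{(2Nfin+1)t₃} < 1/(6·thirdDen·thirdM·P(all)⁵)^{3^{n+1}−1}` into one linear log-inequality.

* `log_heightProd_all` : `log P(all) = hsumS`;
* `log_monDen_thirdBox_le` : `log monDen(all, thirdBox D D_θ s) ≤ (2/3)|s|·(∑ⱼ Dⱼ h(αⱼ) + D_θ h(θ)) + 2·hsumS`;
* `log_thirdDen_schedTwoS_le` : `log thirdDen I s τ ≤ t₀·log ν(H) + |t|·log|b_θ| + (2/3)|s|·hboxR I + 2·hsumS`;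
* `log_thirdM_schedTwoS_le` : `log thirdM I s τ ≤ log #box + (log #box + log Amax3 + log 2) + t₀·log 3 +
  (log 2 + log feldSize (I+1) |s| t₀) + |t|·log Xb3R I + (4/3)|s|·hboxR I + 4·hsumS`.

WHAT THIS IS NOT: the comparison with the budget unit (record, p1); no crux moves.

References: K. Yu, Acta Math. 211 (2013), Lemma 5.4 (5.58)–(5.70); Yu. V. Nesterenko, LNM 1819 (2003), §4.3.
-/

noncomputable section

open Finset Real
open Literature.NumberTheory.Transcendental
open Literature.NumberTheory.Transcendental.CW77 (heightProd hgt)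
open Literature.NumberTheory.Transcendental.CW77.Setup (Tau tauNorm)

namespace Summit.ABC.StewartYu

namespace TwoSetup

open Summit.ABC.StewartYu.G3Boxes

variable (S : TwoSetup) (P : PadicG3Par (S.d + 1))

/-- The total height `hsumS = ∑ⱼ h(αⱼ) + h(θ)`. [folklore] -/
def hsumS : ℝ := ∑ j, Height.logHeight₁ (S.α j) + Height.logHeight₁ S.θ

/-- `0 ≤ hsumS`. [folklore] -/
theorem hsumS_nonneg : 0 ≤ S.hsumS := by
  unfold hsumS
  have : ∀ j, 0 ≤ Height.logHeight₁ (S.α j) := fun j => Height.zero_le_logHeight₁ _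
  have hθ : 0 ≤ Height.logHeight₁ S.θ := Height.zero_le_logHeight₁ _
  positivity

/-- **`log P(all) = hsumS`.** [folklore] -/
theorem log_heightProd_all : Real.log (heightProd S.toQ.all) = S.hsumS := by
  unfold heightProd hsumS SetupQ.all
  rw [Real.log_prod (s := Finset.univ) (fun j _ => (CW77.hgt_pos _).ne'), Fin.sum_univ_castSucc]
  simp only [Fin.snoc_castSucc, Fin.snoc_last, CW77.log_hgt_eq_logHeight₁]

/-- `0 ≤ hboxR I`. [folklore] -/
theorem hboxR_nonneg (I : ℕ) : 0 ≤ S.hboxR P I := by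
  unfold hboxR
  have : ∀ j, 0 ≤ Height.logHeight₁ (S.α j) := fun j => Height.zero_le_logHeight₁ _
  have hθ : 0 ≤ Height.logHeight₁ S.θ := Height.zero_le_logHeight₁ _
  positivity

/-- **The quotient-box monomial denominators**:
`log monDen(all, thirdBox D D_θ s) ≤ (2/3)|s|·(∑ⱼ Dⱼ h(αⱼ) + D_θ h(θ)) + 2·hsumS` (`thirdBoxₖ = ⌊Dₖ|s|/3⌋ + 1`).
[cite: Yu2013, (5.35); shape only] -/
theorem log_monDen_thirdBox_le (Dbox : Fin S.d → ℕ) (Dθ : ℕ) (s : ℤ) :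
    Real.log (MonomialDen.monDen S.toQ.all (S.thirdBox Dbox Dθ s) : ℝ) ≤
      2 / 3 * |(s : ℝ)| * (∑ j, (Dbox j : ℝ) * Height.logHeight₁ (S.α j) + Dθ * Height.logHeight₁ S.θ) +
        2 * S.hsumS := by
  have h := MonomialDen.log_monDen_le S.toQ.all S.toQ.all_ne (S.thirdBox Dbox Dθ s)
  refine h.trans ?_
  -- each `thirdBoxₖ ≤ Dₖ|s|/3 + 1` as reals
  have hk : ∀ k : Fin (S.d + 1), ((S.thirdBox Dbox Dθ s k : ℕ) : ℝ) ≤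
      ((S.boxExp Dbox Dθ s k : ℕ) : ℝ) / 3 + 1 := by
    intro k
    change (((S.boxExp Dbox Dθ s k / 3 + 1 : ℕ)) : ℝ) ≤ _
    push_cast
    have := Nat.cast_div_le (α := ℝ) (m := S.boxExp Dbox Dθ s k) (n := 3)
    push_cast at this
    linarith
  have hx : ((s.natAbs : ℕ) : ℝ) = |(s : ℝ)| := by rw [Nat.cast_natAbs, Int.cast_abs]
  have hterm : ∀ k : Fin (S.d + 1), ((S.thirdBox Dbox Dθ s k : ℕ) : ℝ) * Height.logHeight₁ (S.toQ.all k) ≤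
      (((S.boxExp Dbox Dθ s k : ℕ) : ℝ) / 3 + 1) * Height.logHeight₁ (S.toQ.all k) :=
    fun k => mul_le_mul_of_nonneg_right (hk k) (Height.zero_le_logHeight₁ _)
  have hsum := Finset.sum_le_sum fun k (_ : k ∈ Finset.univ) => hterm k
  refine (mul_le_mul_of_nonneg_left hsum (by norm_num)).trans (le_of_eq ?_)
  unfold hsumS SetupQ.all boxExp
  rw [Fin.sum_univ_castSucc]
  simp only [Fin.snoc_castSucc, Fin.snoc_last]
  push_cast
  rw [hx]
  have e1 : ∑ j : Fin S.d, (((Dbox j : ℝ) * |(s : ℝ)|) / 3 + 1) * Height.logHeight₁ (S.α j) =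
      |(s : ℝ)| / 3 * ∑ j : Fin S.d, (Dbox j : ℝ) * Height.logHeight₁ (S.α j) +
        ∑ j : Fin S.d, Height.logHeight₁ (S.α j) := by
    rw [Finset.mul_sum, ← Finset.sum_add_distrib]
    exact Finset.sum_congr rfl fun j _ => by ring
  rw [e1]
  ring

/-- **`log thirdDen I s τ`** of the schedule of record:
`≤ t₀·log ν(H) + |t|·log|b_θ| + (2/3)|s|·hboxR I + 2·hsumS`. [cite: Yu2013, (5.35); shape only] -/
theorem log_thirdDen_schedTwoS_le (I : ℕ) (s : ℤ) (τ : Tau S.d) :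
    Real.log (thirdDen (S.schedTwoS P) I s τ : ℝ) ≤ τ.1 * Real.log (Nat.lcmUpto P.H) +
      (∑ j, τ.2 j : ℕ) * Real.log (|(S.bθ : ℝ)|) + 2 / 3 * |(s : ℝ)| * S.hboxR P I + 2 * S.hsumS := by
  unfold thirdDen
  rw [schedTwoS_den₀, schedTwoS_Dbox, schedTwoS_Dθ]
  have hν : (0 : ℝ) < (Nat.lcmUpto P.H : ℝ) := by exact_mod_cast Nat.lcmUpto_pos P.H
  have hb : (0 : ℝ) < |(S.bθ : ℝ)| := by rw [abs_pos]; exact_mod_cast S.bθ_ne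
  have hmon : (0 : ℝ) < (MonomialDen.monDen S.toQ.all (S.thirdBox (S.Dbox3R P I) (S.Dθ3R P I) s) : ℝ) := by
    exact_mod_cast MonomialDen.one_le_monDen _ S.toQ.all_ne _
  have hbabs : ((S.bθ.natAbs : ℕ) : ℝ) = |(S.bθ : ℝ)| := by rw [Nat.cast_natAbs, Int.cast_abs]
  push_cast
  rw [hbabs, Real.log_mul (by positivity) hmon.ne', Real.log_mul (by positivity) (by positivity), Real.log_pow,
    Real.log_pow]
  have h := S.log_monDen_thirdBox_le (S.Dbox3R P I) (S.Dθ3R P I) s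
  unfold hboxR
  push_cast
  linarith

/-- **`log thirdM I s τ`** of the schedule of record, closed form. [cite: Yu2013, (5.38); shape only] -/
theorem log_thirdM_schedTwoS_le (I : ℕ) (s : ℤ) (τ : Tau S.d) :
    Real.log (thirdM (S.schedTwoS P) I s τ) ≤
      Real.log ((S.schedTwoS P).cardB I : ℝ) +
        (Real.log ((S.schedTwoS P).cardB 0 : ℝ) + Real.log (S.Amax3 P (S.one_le_T03 P 0)) + Real.log 2) +
        τ.1 * Real.log 3 + (Real.log 2 + Real.log (S.feldSize P (I + 1) |(s : ℝ)| τ.1)) +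
        (∑ j, τ.2 j : ℕ) * Real.log (S.Xb3R P I : ℝ) + 4 / 3 * |(s : ℝ)| * S.hboxR P I + 4 * S.hsumS := by
  -- positivity of every factor
  have hc1 : (1 : ℝ) ≤ ((S.schedTwoS P).cardB I : ℝ) := by
    rw [schedTwoS_cardB, card_famBox]; exact_mod_cast Nat.one_le_iff_ne_zero.mpr (by positivity)
  have hc0 : (1 : ℝ) ≤ ((S.schedTwoS P).cardB 0 : ℝ) := by
    rw [schedTwoS_cardB, card_famBox]; exact_mod_cast Nat.one_le_iff_ne_zero.mpr (by positivity)
  have hA1 : (1 : ℝ) ≤ S.Amax3 P (S.one_le_T03 P 0) := le_max_left _ _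
  have hP1 : (1 : ℝ) ≤ ((S.schedTwoS P).P : ℝ) := by
    rw [schedTwoS_P]
    have hcf : (1 : ℝ) ≤ ((famBox P.L₀ (S.Dbox3 P 0) (S.Dθ3 P 0)).card : ℝ) := by
      rw [card_famBox]; exact_mod_cast Nat.one_le_iff_ne_zero.mpr (by positivity)
    exact_mod_cast Int.one_le_ceil_iff.mpr (by nlinarith)
  have hM1 : (1 : ℝ) ≤ ((S.schedTwoS P).M₀ (I + 1) s τ : ℝ) := by rw [schedTwoS_M₀]; exact S.one_le_M₀3 P _ s τ
  have hX1 : (1 : ℝ) ≤ ((S.schedTwoS P).Xb I : ℝ) := by rw [schedTwoS_Xb]; exact_mod_cast S.one_le_Xb3R P I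
  have hmon1 : (1 : ℝ) ≤ (MonomialDen.monDen S.toQ.all
      (S.thirdBox ((S.schedTwoS P).Dbox I) ((S.schedTwoS P).Dθ I) s) : ℝ) := by
    exact_mod_cast MonomialDen.one_le_monDen _ S.toQ.all_ne _
  have hf1 := S.one_le_feldSize P (I + 1) (abs_nonneg (s : ℝ)) τ.1
  have hh := S.hboxR_nonneg P I
  have hs := S.hsumS_nonneg
  -- the logs of the factors
  have lP := S.log_P_schedTwoS_le P
  have lM : Real.log ((S.schedTwoS P).M₀ (I + 1) s τ : ℝ) ≤
      Real.log 2 + Real.log (S.feldSize P (I + 1) |(s : ℝ)| τ.1) := by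
    rw [schedTwoS_M₀]; exact S.log_M₀3_le P (I + 1) le_rfl le_rfl
  have lmon : Real.log (MonomialDen.monDen S.toQ.all
      (S.thirdBox ((S.schedTwoS P).Dbox I) ((S.schedTwoS P).Dθ I) s) : ℝ) ≤
      2 / 3 * |(s : ℝ)| * S.hboxR P I + 2 * S.hsumS := by
    rw [schedTwoS_Dbox, schedTwoS_Dθ]
    have := S.log_monDen_thirdBox_le (S.Dbox3R P I) (S.Dθ3R P I) s
    unfold hboxR; exact this
  -- the RHS is nonnegative, so `log (max 1 y) ≤ RHS` follows from `log y ≤ RHS`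
  have hRHS : 0 ≤ Real.log ((S.schedTwoS P).cardB I : ℝ) +
      (Real.log ((S.schedTwoS P).cardB 0 : ℝ) + Real.log (S.Amax3 P (S.one_le_T03 P 0)) + Real.log 2) +
      τ.1 * Real.log 3 + (Real.log 2 + Real.log (S.feldSize P (I + 1) |(s : ℝ)| τ.1)) +
      (∑ j, τ.2 j : ℕ) * Real.log (S.Xb3R P I : ℝ) + 4 / 3 * |(s : ℝ)| * S.hboxR P I + 4 * S.hsumS := by
    have := Real.log_nonneg hc1; have := Real.log_nonneg hc0; have := Real.log_nonneg hA1
    have := Real.log_nonneg hf1; have : 0 ≤ Real.log (2 : ℝ) := Real.log_nonneg (by norm_num)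
    have : 0 ≤ Real.log (3 : ℝ) := Real.log_nonneg (by norm_num)
    have : 0 ≤ Real.log (S.Xb3R P I : ℝ) := Real.log_nonneg (by exact_mod_cast S.one_le_Xb3R P I)
    positivity
  unfold thirdM
  rcases le_total (((S.schedTwoS P).cardB I : ℝ) * (S.schedTwoS P).P *
      ((3 : ℝ) ^ τ.1 * (S.schedTwoS P).M₀ (I + 1) s τ * ((S.schedTwoS P).Xb I : ℝ) ^ (∑ j, τ.2 j) *
        ((MonomialDen.monDen S.toQ.all (S.thirdBox ((S.schedTwoS P).Dbox I) ((S.schedTwoS P).Dθ I) s) : ℝ))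
          ^ 2)) 1 with h1 | h1
  · rw [max_eq_left h1, Real.log_one]; exact hRHS
  · rw [max_eq_right h1]
    rw [Real.log_mul (by positivity) (by positivity), Real.log_mul (by positivity) (by positivity),
      Real.log_mul (by positivity) (by positivity), Real.log_mul (by positivity) (by positivity),
      Real.log_mul (by positivity) (by positivity), Real.log_pow, Real.log_pow, Real.log_pow]
    have hXlog : 0 ≤ Real.log ((S.schedTwoS P).Xb I : ℝ) := Real.log_nonneg hX1
    rw [schedTwoS_Xb] at hXlog ⊢
    push_cast
    nlinarith [lP, lM, lmon, hXlog]

end TwoSetup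

end Summit.ABC.StewartYu

end
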